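import Literature.AlgebraicGeometry.Motives.HodgeStructureCentralizerSemisimple
import Literature.AlgebraicGeometry.Motives.HodgeStructureCentralizerInternalBlocks
import Literature.AlgebraicGeometry.Motives.HodgeStructureStableSubHodgeStructuresMinimal
import Literature.AlgebraicGeometry.Motives.HodgeStructureStableSubHodgeStructuresIsotypicComponents
import Literature.AlgebraicGeometry.Motives.HodgeStructureStableSubHodgeStructuresCanonicalCentre
import HarnessLib

/-!
# THE WEDDERBURN FACTORS OF MILNE'S `(C(A), †)` ARE THE `(C(S_i), †_i)` OVER THE CANONICAL BLOCKS: for an `E_φ`-stable `S ≠ 0`,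
# `C(S)` is SIMPLE iff `S` is a minimal stable sub-Hodge structure; `(C(H), †) ≃ₐ ∏_i (C(S_i), †_i)` with every factor simple;
# `C(H)` is simple iff there is exactly one canonical block; `†` is of the first kind on `Z(C(H))` iff it is on `Z(E_φ)`, iff
# the centre is totally real (Milne 1999 §1 Prop. 1.1, p. 644 L22–L24, §2 pp. 645–646)

[topic AlgebraicGeometry/Motives]

Layer `Literature/AlgebraicGeometry/Motives`, lane `lit-hodgefound` (Track 2 foundations library; prover seat
`lit-hodgefound-p02`, generation 54, self-proposed row g54-#3). THEOREMS ONLY: no definition, no named fact (net debt `0`),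
no instance, no notation.  Third file of the theme «`(C(A), †)` is a semisimple `k`-algebra with involution» (g54-#1
`Motives/HodgeStructureCentralizerSemisimple`: semisimple, simple iff `E_φ` simple, centre `Z(E_φ)`; g54-#2: on `K`-points).  Milne
computes `C(A)` and `S(A)` «in the case that `A` is simple» after Prop. 1.1/1.5; intrinsically the reduction is to the CANONICAL
BLOCKS — the minimal non-zero `E_φ`-stable sub-Hodge structures `S_i` (= isotypic components, the tree's g51/g52 files
`Motives/HodgeStructureStableSubHodgeStructures*`), along which `(C(H), †) ≃ₐ ∏_i (C(S_i), †_i)` (the tree's g52-#3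
`Polarization.exists_algEquiv_pi_centralizer_minimal_stable_adjoint`, `Motives/HodgeStructureCentralizerInternalBlocks`).  This file
identifies those blocks as the WEDDERBURN FACTORS of the semisimple algebra `C(H)`: for an `E_φ`-stable `S ≠ 0`, `C(S)` is simple
iff `S` is minimal (g54-#1's «`C` simple iff `E_φ` simple» for `S` + the tree's «`E_φ(S)` simple iff `S` minimal»,
`Polarization.isSimpleRing_endAlg_iff_forall_stable_le`), so every factor `C(S_i)` is simple with a field as centre, `C(H)` is
simple iff there is exactly ONE canonical block, and `dim E_φ(S_i) · dim C(S_i) = (dim S_i)²` block by block.  Finally the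
involution on the centre: `†` fixes `Z(C(H))` pointwise iff it fixes `Z(E_φ)` pointwise (same subalgebra of `End_ℚ(V)`, g54-#1), hence
— when the centre is a field `K` — iff `K` is totally real (the tree's `Polarization.forall_adjointEndAlg_center_eq_self_iff_isTotallyReal`,
`Motives/HodgeStructureRosatiCentreFactors`): «first kind» on `C(A)` for types I–III, «second kind» for type IV.

## The sources, verbatim

* J. S. Milne, *Lefschetz classes on abelian varieties*, Duke Math. J. 96 (1999) 639–675 [Milne1999LefschetzClasses] (held
  `paper:doi-10-1215-s0012-7094-99-09620-5`, folios 5–8): p. 643 L13–L15 "`C(A) ⊂ C(A₁) × ⋯ × C(A_s)`, with equality holding if and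
  only if `Hom(A_i, A_j) = 0`"; **Prop. 1.1** "`C(A₁) × ⋯ × C(A_s) → C(A)` of `k`-algebras with involution"; p. 644 L22–L24 "It
  is a reductive group (not necessarily connected) over `k` whose nonabelian simple quotients are classical groups (cf. Weil
  1960)."; §2 p. 645 L30–L33 "After Propositions 1.1 and 1.5 it suffices to do this in the case that `A` is simple"; p. 646
  "`E = End⁰(A)` (a division algebra), `K` = the centre of `E` (a field), `F` = the subfield of `K` on which the Rosati
  involutions act trivially […] `K` equals `F` except when `A` is of type IV".
* H. Lange, *Abelian Varieties over the Complex Numbers* (2023) [Lange2023AbelianVarietiesComplex], §2.4.4 Cor. 2.4.26 (p. 124)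
  (`End_ℚ(X) ≃ ⊕_ν M_{n_ν}(F_ν)` along the isotypic decomposition) and §2.6.2 (p. 141), Lemma 2.6.4 («of the first kind if the
  anti-involution is trivial on the centre»).
* T. Y. Lam, *A First Course in Noncommutative Rings* (2001) [Lam2001FirstCourse], §22 (22.1)–(22.2) (p. 326): the block
  decomposition of a ring by centrally primitive idempotents; J. Voight, *Quaternion Algebras* [Voight2021], §7.7 Prop. 7.7.8.

## Dictionary and what is proved (namespace `Literature.AlgebraicGeometry.Motives.HodgeStructure`)

`C(S) = Subalgebra.centralizer ℚ (S.toHodgeStructure.endAlg : Set (Module.End ℚ S))` for a sub-Hodge structure `S`; «`E_φ`-stable»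
`= ∀ a ∈ E_φ, a S ⊆ S`; «canonical block» = minimal non-zero `E_φ`-stable (the subtype used throughout the g51/g52 files).

* §1 **`Polarization.isSimpleRing_centralizer_endAlg_iff_forall_stable_le`** (stable `S ≠ 0`: `C(S)` simple iff `S` minimal),
  **`isSimpleRing_centralizer_endAlg_of_minimal_stable`**, `isField_center_centralizer_endAlg_of_minimal_stable`,
  `finrank_endAlg_mul_finrank_centralizer_endAlg_of_minimal_stable` (`dim E_φ(S) · dim C(S) = (dim S)²`).
* §2 **`Polarization.exists_algEquiv_pi_centralizer_minimal_stable_adjoint_isSimpleRing`** — THE WEDDERBURN DECOMPOSITION OF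
  `(C(H), †)`: `e : C(H) ≃ₐ[ℚ] ∏_i C(S_i)` by restriction (`(e c)_i v = c v`), `e (c†) = (e c)^{†}` factorwise, every `C(S_i)` simple.
* §3 **`isSimpleRing_centralizer_endAlg_iff_natCard_minimal_stable_eq_one`** (`C(H)` simple iff exactly one canonical block).
* §4 the involution on the centre: **`Polarization.forall_adjoint_center_centralizer_endAlg_eq_self_iff`** (`†` fixes `Z(C(H))`
  pointwise iff it fixes `Z(E_φ)` pointwise), `Polarization.forall_adjoint_center_centralizer_endAlg_eq_self_iff_isTotallyReal`
  (centre a field `K`: iff `K` is totally real — first kind), `Polarization.exists_adjoint_center_centralizer_endAlg_ne_of_isCMField`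
  (CM centre: second kind).
-/

noncomputable section

namespace Literature.AlgebraicGeometry.Motives

namespace HodgeStructure

universe u

variable {V : Type u} [AddCommGroup V] [Module ℚ V] [Module.Finite ℚ V] {n : ℤ} {H : HodgeStructure V n}

/-! ## §1 `C(S)` is simple iff `S` is a canonical block -/

/-- **FOR AN `E_φ`-STABLE `S ≠ 0`: `C(S)` IS SIMPLE IFF `S` IS MINIMAL AMONG THE NON-ZERO `E_φ`-STABLE SUB-HODGE STRUCTURES** —
`C(S)` is simple iff `E_φ(S)` is (g54-#1, for the polarizable `S`), iff `S` is minimal (the tree's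
`Polarization.isSimpleRing_endAlg_iff_forall_stable_le`): the simple factors of `C(A)` sit over the isotypic pieces
`A_i^{r_i}`, «it suffices to do this in the case that `A` is simple». [cite: Milne1999LefschetzClasses, §1 Prop. 1.1 and §2 p. 645 L30–L33]
[cite: Lange2023AbelianVarietiesComplex, §2.4.4 Cor. 2.4.26 (p. 124)] [cite: Lam2001FirstCourse, §22 (22.1)–(22.2) (p. 326)] -/
theorem Polarization.isSimpleRing_centralizer_endAlg_iff_forall_stable_le (ψ : Polarization H) {S : SubHodgeStructure H}
    (hS : ∀ a ∈ H.endAlg, ∀ v ∈ S.toSubmodule, a v ∈ S.toSubmodule) (hS0 : S.toSubmodule ≠ ⊥) :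
    IsSimpleRing (Subalgebra.centralizer ℚ
        (S.toHodgeStructure.endAlg : Set (Module.End ℚ S.toSubmodule))) ↔
      ∀ S' : SubHodgeStructure H, (∀ a ∈ H.endAlg, ∀ v ∈ S'.toSubmodule, a v ∈ S'.toSubmodule) →
        S'.toSubmodule ≤ S.toSubmodule → S'.toSubmodule = ⊥ ∨ S'.toSubmodule = S.toSubmodule :=
  (isSimpleRing_centralizer_endAlg_iff S.toHodgeStructure ⟨ψ.restrict S⟩).trans
    (ψ.isSimpleRing_endAlg_iff_forall_stable_le hS hS0)

/-- **`C(S)` IS SIMPLE FOR EVERY CANONICAL BLOCK `S`** (minimal non-zero `E_φ`-stable sub-Hodge structure of a polarizable `H`):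
the Wedderburn factors of `C(H)`. [cite: Milne1999LefschetzClasses, §1 Prop. 1.1 and §2 p. 645 L30–L33]
[cite: Lange2023AbelianVarietiesComplex, §2.4.4 Cor. 2.4.26 (p. 124)] -/
theorem isSimpleRing_centralizer_endAlg_of_minimal_stable (hH : H.IsPolarizable) {S : SubHodgeStructure H}
    (hS : (∀ a ∈ H.endAlg, ∀ v ∈ S.toSubmodule, a v ∈ S.toSubmodule) ∧ S.toSubmodule ≠ ⊥ ∧
      ∀ S' : SubHodgeStructure H, (∀ a ∈ H.endAlg, ∀ v ∈ S'.toSubmodule, a v ∈ S'.toSubmodule) →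
        S'.toSubmodule ≤ S.toSubmodule → S'.toSubmodule = ⊥ ∨ S'.toSubmodule = S.toSubmodule) :
    IsSimpleRing (Subalgebra.centralizer ℚ (S.toHodgeStructure.endAlg : Set (Module.End ℚ S.toSubmodule))) := by
  obtain ⟨ψ⟩ := hH
  exact (ψ.isSimpleRing_centralizer_endAlg_iff_forall_stable_le hS.1 hS.2.1).2 hS.2.2

/-- **The centre of each factor `C(S_i)` is a FIELD** (`Z(C(S)) ≅ Z(E_φ(S))`, the centre of a simple algebra; Milne's `K` = «the
centre of `E` (a field)»). [cite: Milne1999LefschetzClasses, §2 p. 646 («K = the centre of E (a field)»)]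
[cite: Cohn2000IntroductionRingTheory, §2.3 Exercise 6 (p. 72; solution p. 183)] -/
theorem isField_center_centralizer_endAlg_of_minimal_stable (hH : H.IsPolarizable) {S : SubHodgeStructure H}
    (hS : (∀ a ∈ H.endAlg, ∀ v ∈ S.toSubmodule, a v ∈ S.toSubmodule) ∧ S.toSubmodule ≠ ⊥ ∧
      ∀ S' : SubHodgeStructure H, (∀ a ∈ H.endAlg, ∀ v ∈ S'.toSubmodule, a v ∈ S'.toSubmodule) →
        S'.toSubmodule ≤ S.toSubmodule → S'.toSubmodule = ⊥ ∨ S'.toSubmodule = S.toSubmodule) :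
    IsField (Subalgebra.center ℚ (Subalgebra.centralizer ℚ
      (S.toHodgeStructure.endAlg : Set (Module.End ℚ S.toSubmodule)))) := by
  obtain ⟨ψ⟩ := hH
  haveI : Nontrivial S.toSubmodule := Submodule.nontrivial_iff_ne_bot.2 hS.2.1
  exact (isSimpleRing_centralizer_endAlg_iff_isField_center S.toHodgeStructure ⟨ψ.restrict S⟩).1
    (isSimpleRing_centralizer_endAlg_of_minimal_stable ⟨ψ⟩ hS)

/-- **`dim_ℚ E_φ(S) · dim_ℚ C(S) = (dim_ℚ S)²` FOR EVERY CANONICAL BLOCK `S`** (`E_φ(S)` is simple; Voight Prop. 7.7.8 (b) inside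
`End_ℚ(S)`) — the block-by-block dimension count of Milne's §2 (type I: `C_i = End_{F_i}(V_i) ≈ M_{2g/f}(F_i)`).
[cite: Milne1999LefschetzClasses, §2 pp. 645–648] [cite: Voight2021, §7.7 Prop. 7.7.8 (b)] -/
theorem finrank_endAlg_mul_finrank_centralizer_endAlg_of_minimal_stable (hH : H.IsPolarizable) {S : SubHodgeStructure H}
    (hS : (∀ a ∈ H.endAlg, ∀ v ∈ S.toSubmodule, a v ∈ S.toSubmodule) ∧ S.toSubmodule ≠ ⊥ ∧
      ∀ S' : SubHodgeStructure H, (∀ a ∈ H.endAlg, ∀ v ∈ S'.toSubmodule, a v ∈ S'.toSubmodule) →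
        S'.toSubmodule ≤ S.toSubmodule → S'.toSubmodule = ⊥ ∨ S'.toSubmodule = S.toSubmodule) :
    Module.finrank ℚ S.toHodgeStructure.endAlg *
        Module.finrank ℚ (Subalgebra.centralizer ℚ (S.toHodgeStructure.endAlg : Set (Module.End ℚ S.toSubmodule))) =
      Module.finrank ℚ S.toSubmodule * Module.finrank ℚ S.toSubmodule := by
  obtain ⟨ψ⟩ := hH
  exact finrank_endAlg_mul_finrank_centralizer_endAlg S.toHodgeStructure
    ((ψ.isSimpleRing_endAlg_iff_forall_stable_le hS.1 hS.2.1).2 hS.2.2)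

/-! ## §2 The Wedderburn decomposition of `(C(H), †)` over the canonical blocks -/

open Classical in
/-- **THE WEDDERBURN DECOMPOSITION OF `(C(H), †)`: `(C(H), †) ≃ₐ[ℚ] ∏_i (C(S_i), †_i)` OVER THE CANONICAL BLOCKS, EVERY FACTOR SIMPLE**
— for a polarized `ℚ`-Hodge structure, restriction to the minimal `E_φ`-stable sub-Hodge structures `S_i` is an isomorphism of
`ℚ`-algebras `e` with `(e c)_i v = c v`, carrying the involution `†` of `ψ` to the involutions `†_i` of the restricted
polarizations `ψ|_{S_i}` (the tree's g52-#3 `Polarization.exists_algEquiv_pi_centralizer_minimal_stable_adjoint`), and every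
factor `C(S_i)` is a SIMPLE algebra (§1) — Milne's Prop. 1.1 «of `k`-algebras with involution» read as the decomposition of the
semisimple algebra with involution `(C(A), †)` into simple algebras with involution, one per isotypic component.
[cite: Milne1999LefschetzClasses, §1 p. 643 L13–L15, Prop. 1.1 and p. 644 L22–L24] [cite: Lange2023AbelianVarietiesComplex, §2.4.4 Cor. 2.4.26 (p. 124)]
[cite: Lam2001FirstCourse, §22 (22.1)–(22.2) (p. 326)] -/
theorem Polarization.exists_algEquiv_pi_centralizer_minimal_stable_adjoint_isSimpleRing (ψ : Polarization H) :
    ∃ e : Subalgebra.centralizer ℚ (H.endAlg : Set (Module.End ℚ V)) ≃ₐ[ℚ]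
        Π S : {S : SubHodgeStructure H // (∀ a ∈ H.endAlg, ∀ v ∈ S.toSubmodule, a v ∈ S.toSubmodule) ∧ S.toSubmodule ≠ ⊥ ∧
      ∀ S' : SubHodgeStructure H, (∀ a ∈ H.endAlg, ∀ v ∈ S'.toSubmodule, a v ∈ S'.toSubmodule) →
        S'.toSubmodule ≤ S.toSubmodule → S'.toSubmodule = ⊥ ∨ S'.toSubmodule = S.toSubmodule},
          Subalgebra.centralizer ℚ (((S : SubHodgeStructure H)).toHodgeStructure.endAlg :
            Set (Module.End ℚ (S : SubHodgeStructure H).toSubmodule)),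
      (∀ (c : Subalgebra.centralizer ℚ (H.endAlg : Set (Module.End ℚ V)))
          (S : {S : SubHodgeStructure H // (∀ a ∈ H.endAlg, ∀ v ∈ S.toSubmodule, a v ∈ S.toSubmodule) ∧ S.toSubmodule ≠ ⊥ ∧
      ∀ S' : SubHodgeStructure H, (∀ a ∈ H.endAlg, ∀ v ∈ S'.toSubmodule, a v ∈ S'.toSubmodule) →
        S'.toSubmodule ≤ S.toSubmodule → S'.toSubmodule = ⊥ ∨ S'.toSubmodule = S.toSubmodule})
          (v : (S : SubHodgeStructure H).toSubmodule),
        ((e c S : Module.End ℚ (S : SubHodgeStructure H).toSubmodule) v : V) = (c : Module.End ℚ V) v) ∧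
      (∀ (c : Subalgebra.centralizer ℚ (H.endAlg : Set (Module.End ℚ V)))
          (S : {S : SubHodgeStructure H // (∀ a ∈ H.endAlg, ∀ v ∈ S.toSubmodule, a v ∈ S.toSubmodule) ∧ S.toSubmodule ≠ ⊥ ∧
      ∀ S' : SubHodgeStructure H, (∀ a ∈ H.endAlg, ∀ v ∈ S'.toSubmodule, a v ∈ S'.toSubmodule) →
        S'.toSubmodule ≤ S.toSubmodule → S'.toSubmodule = ⊥ ∨ S'.toSubmodule = S.toSubmodule}),
        ((e ⟨ψ.adjoint c, ψ.adjoint_mem_centralizer_endAlg c.2⟩ S) :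
            Module.End ℚ (S : SubHodgeStructure H).toSubmodule) =
          (ψ.restrict (S : SubHodgeStructure H)).adjoint (e c S)) ∧
      ∀ S : {S : SubHodgeStructure H // (∀ a ∈ H.endAlg, ∀ v ∈ S.toSubmodule, a v ∈ S.toSubmodule) ∧ S.toSubmodule ≠ ⊥ ∧
      ∀ S' : SubHodgeStructure H, (∀ a ∈ H.endAlg, ∀ v ∈ S'.toSubmodule, a v ∈ S'.toSubmodule) →
        S'.toSubmodule ≤ S.toSubmodule → S'.toSubmodule = ⊥ ∨ S'.toSubmodule = S.toSubmodule},
        IsSimpleRing (Subalgebra.centralizer ℚ (((S : SubHodgeStructure H)).toHodgeStructure.endAlg :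
          Set (Module.End ℚ (S : SubHodgeStructure H).toSubmodule))) := by
  obtain ⟨e, he, hadj⟩ := ψ.exists_algEquiv_pi_centralizer_minimal_stable_adjoint
  exact ⟨e, he, hadj, fun S => isSimpleRing_centralizer_endAlg_of_minimal_stable ⟨ψ⟩ S.2⟩

/-! ## §3 `C(H)` is simple iff there is exactly one canonical block -/

/-- **`C(H)` IS SIMPLE IFF `H` HAS EXACTLY ONE CANONICAL BLOCK** (polarizable `H`, `V ≠ 0`): `C(H)` is simple iff `E_φ` is
(g54-#1), iff an isotypically labelled irreducible decomposition has one class (the tree's `isSimpleRing_endAlg_iff_card_eq_one`),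
and the number of classes is the number of minimal non-zero `E_φ`-stable sub-Hodge structures (the tree's
`natCard_minimal_stable_eq_card`) — the number of simple factors of `C(A)` is the number of simple isogeny classes among the
factors of `A`. [cite: Milne1999LefschetzClasses, §1 Prop. 1.1 and §2 p. 645 L30–L33] [cite: Lange2023AbelianVarietiesComplex, §2.4.4 Cor. 2.4.26 (p. 124)]
[cite: Lam2001FirstCourse, §22 Prop. (22.1)–(22.2) (p. 326)] -/
theorem isSimpleRing_centralizer_endAlg_iff_natCard_minimal_stable_eq_one [Nontrivial V] (hH : H.IsPolarizable) :
    IsSimpleRing (Subalgebra.centralizer ℚ (H.endAlg : Set (Module.End ℚ V))) ↔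
      Nat.card {S : SubHodgeStructure H // (∀ a ∈ H.endAlg, ∀ v ∈ S.toSubmodule, a v ∈ S.toSubmodule) ∧ S.toSubmodule ≠ ⊥ ∧
        ∀ S' : SubHodgeStructure H, (∀ a ∈ H.endAlg, ∀ v ∈ S'.toSubmodule, a v ∈ S'.toSubmodule) →
          S'.toSubmodule ≤ S.toSubmodule → S'.toSubmodule = ⊥ ∨ S'.toSubmodule = S.toSubmodule} = 1 := by
  obtain ⟨s, _, κ, c, hint, hirr, hc, hκ⟩ := exists_isInternal_isIrreducible_labelling H hH
  have hirr' : ∀ x : s, (x : SubHodgeStructure H).toHodgeStructure.IsIrreducible := fun x => hirr x x.2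
  haveI := nonempty_of_isInternal hint
  rw [isSimpleRing_centralizer_endAlg_iff H hH,
    isSimpleRing_endAlg_iff_card_eq_one (fun S : s => (S : SubHodgeStructure H)) hint hc hκ hirr',
    natCard_minimal_stable_eq_card (fun S : s => (S : SubHodgeStructure H)) hint hc hκ hirr', Fintype.card_coe]

/-! ## §4 The involution on the centre: first kind on `C(H)` iff first kind on `E_φ` -/

/-- **`†` FIXES `Z(C(H))` POINTWISE IFF IT FIXES `Z(E_φ)` POINTWISE** (polarized `H`): the two centres are the same subalgebra
`E_φ ∩ C(H)` of `End_ℚ(V)` (g54-#1 `map_val_center_centralizer_endAlg_eq`, the tree's `map_val_center_endAlg_eq_endAlg_inf_centralizer_endAlg`)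
and `†` is the `ψ`-adjoint on both — so «the subfield of `K` on which the Rosati involutions act trivially» is read equally on
`C(A)` or on `End⁰(A)`. [cite: Milne1999LefschetzClasses, §1 p. 643 L1–L2, Remark 1.2 and §2 p. 646]
[cite: Lange2023AbelianVarietiesComplex, §2.6.2 (p. 141)] -/
theorem Polarization.forall_adjoint_center_centralizer_endAlg_eq_self_iff (ψ : Polarization H) :
    (∀ z : Subalgebra.centralizer ℚ (H.endAlg : Set (Module.End ℚ V)),
        z ∈ Subalgebra.center ℚ (Subalgebra.centralizer ℚ (H.endAlg : Set (Module.End ℚ V))) →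
          ψ.adjoint (z : Module.End ℚ V) = z) ↔
      ∀ z : H.endAlg, z ∈ Subalgebra.center ℚ H.endAlg → ψ.adjoint (z : Module.End ℚ V) = z := by
  constructor
  · intro h z hz
    have hzC := (mem_center_endAlg_iff_coe_mem_centralizer_endAlg H z).1 hz
    exact h ⟨(z : Module.End ℚ V), hzC⟩ ((mem_center_centralizer_endAlg_iff H ⟨ψ⟩ _).2 z.2)
  · intro h z hz
    have hzE := (mem_center_centralizer_endAlg_iff H ⟨ψ⟩ z).1 hz
    exact h ⟨(z : Module.End ℚ V), hzE⟩ ((mem_center_endAlg_iff_coe_mem_centralizer_endAlg H _).2 z.2)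

/-- **FIRST KIND ON `C(H)` ⟺ TOTALLY REAL CENTRE**: when the centre `Z(E_φ) = Z(C(H))` is a field `K` (the isotypic case), `†`
fixes `Z(C(H))` pointwise iff `K` is totally real (types I–III; the tree's `Polarization.forall_adjointEndAlg_center_eq_self_iff_isTotallyReal`
for `E_φ`, transported by the previous statement) — Milne's «`F` = the subfield of `K` on which the Rosati involutions act trivially
[…] `K` equals `F` except when `A` is of type IV». [cite: Milne1999LefschetzClasses, §2 p. 646] [cite: Lange2023AbelianVarietiesComplex, §2.6.2 (p. 141) and Lemma 2.6.4]
[cite: Shimura1998, §5.1 Lemma 2 (p. 36)] -/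
theorem Polarization.forall_adjoint_center_centralizer_endAlg_eq_self_iff_isTotallyReal {K : Type*} [Field K] [NumberField K]
    (ψ : Polarization H) (g : K ≃+* Subring.center H.endAlg) :
    (∀ z : Subalgebra.centralizer ℚ (H.endAlg : Set (Module.End ℚ V)),
        z ∈ Subalgebra.center ℚ (Subalgebra.centralizer ℚ (H.endAlg : Set (Module.End ℚ V))) →
          ψ.adjoint (z : Module.End ℚ V) = z) ↔
      NumberField.IsTotallyReal K := by
  rw [ψ.forall_adjoint_center_centralizer_endAlg_eq_self_iff, ← ψ.forall_adjointEndAlg_center_eq_self_iff_isTotallyReal g]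
  constructor
  · intro h z
    refine Subtype.ext ?_
    rw [Polarization.coe_adjointEndAlg_apply]
    exact h (z : H.endAlg) (Subalgebra.mem_center_iff.2 fun b => Subring.mem_center_iff.1 z.2 b)
  · intro h z hz
    have h' := congrArg Subtype.val (h ⟨z, Subring.mem_center_iff.2 fun b => Subalgebra.mem_center_iff.1 hz b⟩)
    rwa [Polarization.coe_adjointEndAlg_apply] at h'

/-- **SECOND KIND ON `C(H)` FOR A CM CENTRE**: when `Z(E_φ) = Z(C(H))` is a CM field `K` (type IV), `†` moves some central element
of `C(H)` (the tree's `Polarization.exists_adjointEndAlg_center_ne_of_isCMField`, transported).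
[cite: Milne1999LefschetzClasses, §2 p. 646 («a CM-field of degree 2 over F»)] [cite: Lange2023AbelianVarietiesComplex, §2.6.2 Lemma 2.6.6 (p. 144)] -/
theorem Polarization.exists_adjoint_center_centralizer_endAlg_ne_of_isCMField {K : Type*} [Field K] [NumberField K]
    [NumberField.IsCMField K] (ψ : Polarization H) (g : K ≃+* Subring.center H.endAlg) :
    ∃ z : Subalgebra.centralizer ℚ (H.endAlg : Set (Module.End ℚ V)),
      z ∈ Subalgebra.center ℚ (Subalgebra.centralizer ℚ (H.endAlg : Set (Module.End ℚ V))) ∧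
        ψ.adjoint (z : Module.End ℚ V) ≠ z := by
  by_contra hall
  push Not at hall
  have hTR : NumberField.IsTotallyReal K :=
    (ψ.forall_adjoint_center_centralizer_endAlg_eq_self_iff_isTotallyReal g).1 hall
  obtain ⟨z, hz⟩ := ψ.exists_adjointEndAlg_center_ne_of_isCMField g
  have hall' := (ψ.forall_adjointEndAlg_center_eq_self_iff_isTotallyReal g).2 hTR z
  exact hz hall'

end HodgeStructure

end Literature.AlgebraicGeometry.Motives
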